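import Summits.CriticalPhenomena.PercolationContinuityZ3.Theorems.PercNearOneGluingNoHeavyLowerTailSunflowerMultiPetalKempeMarkedTIDefs
import HarnessLib
import HarnessLib.Audit

/-!
# `NoHeavyLowerTail` (crux stmt-CriticalPhenomena-4575), marked multigraphs, THEOREM TI2: the TERMINAL-ISOLATED case — if no vertex other than the
# special vertex `s` is joined to the (unmarked) terminals, `TI₀(K; s,u,v) ≥ 0` by reduction to LEMMA B for `K − u − v`

Support file (seat `prim-l12-p2` gen 52; `--supports stmt-CriticalPhenomena-4575`; continuation of `…KempeMarkedTIDefs`).  No `sorry`; nothing is asserted about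
the crux.  Memo: run/shared/lean/prim/prim-l12/prim-l12-p2/PROOF-TI2-MARKED-MULTIGRAPHS-g51.md §2 (cases (c) and (f), merged here into one statement).

SETTING: terminals `u ≠ v` unmarked, `s ∉ {u,v}`, and every vertex `w ∉ {u,v,s}` has `mul w u = mul w v = 0` (`s` itself may be joined to `u`, `v` with any
multiplicities `ν_su, ν_sv`, and may be marked).  With `L = (K.isolate u).isolate v` (a marked multigraph in which `u, v` are free):
* `ctypeM_eq_of_terminalIsolated` — `type_K σ = type_L σ ⊕ [σ s = 0]·(ν_su ∧ 2)e₀ ⊕ [σ s = 1]·(ν_sv ∧ 2)e₁` on the terminal-coloured colourings;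
* `nine_mul_TIfun_eq_sum` — `9·TI₀(K) = Σ_{all σ} gCF (type_L σ) (σ s)` (`u, v` free in `L`);
* `sum_pin_perm` — colour relabelling of a pinned sum (`Σ_{σ s = π c} g(type) = Σ_{σ s = c} g(permCT ψ type)`), used three times: the classes `σ s = 1`,
  `σ s = 2` are carried onto `σ s = 0` (swaps `0↔1`, `0↔2`), and the class `σ s = 0` is symmetrised under `1↔2`;
* `kappaCF_symm_ge` (finite check) — the symmetrised kernel dominates `m·lbW` pointwise, `m = 6` if `ν_sv = 0` and `m = 4` otherwise;
* **`TIfun_nonneg_of_terminalIsolated`** — hence `18·TI₀(K) ≥ (m/3)·Q(L) ≥ 0` by LEMMA B (`QcolM_nonneg`, p609343).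
-/

namespace Summit.CriticalPhenomena.PercolationContinuityZ3.Theorems.SunflowerPartition.Kempe

open Finset

/-! ## Kernels of the terminal-isolated case (finite checks) -/

/-- The integrand of `9·TI₀` on `L`-types: `s ↦ 0` sees `ν_su + 1` marks' worth at `u`, `s ↦ 1` sees `ν_sv` at `v`, `s ↦ 2` nothing. [this work] -/
def gCF (c₁ c₂ : Fin 3) (t : CType) (z : Fin 3) : ℤ :=
  if z = 0 then fC (ctAdd t (capAdd c₁ 1, 0, 0)) else if z = 1 then 2 * fC (ctAdd t (0, c₂, 0)) else 2 * fC t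

/-- The three classes folded onto `σ s = 0`: `κ(t) = fC(t ⊕ (c₁+1)e₀) + 2·fC(swap₀₁ t ⊕ c₂e₁) + 2·fC(swap₀₂ t)`. [this work] -/
def kappaCF (c₁ c₂ : Fin 3) (t : CType) : ℤ :=
  fC (ctAdd t (capAdd c₁ 1, 0, 0)) + 2 * fC (ctAdd (t.2.1, t.1, t.2.2) (0, c₂, 0)) + 2 * fC (t.2.2, t.2.1, t.1)

/-- **The symmetrised kernel dominates Lemma B's kernel**: `κ(t) + κ(swap₁₂ t) ≥ m·lbW t` with `m = 6` (`c₂ = 0`) or `4` (`c₂ ≠ 0`). (finite check) [this work] -/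
theorem kappaCF_symm_ge : ∀ (c₁ c₂ : Fin 3) (t : CType),
    (if c₂ = 0 then 6 else 4) * lbW t ≤ kappaCF c₁ c₂ t + kappaCF c₁ c₂ (t.1, t.2.2, t.2.1) := by decide +kernel

/-- `gCF` on the weight class is the half-marked kernel shifted by `ν_su`. (finite check) [this work] -/
theorem hWt_zero_shift : ∀ (t : CType) (c₁ c₂ : Fin 3) (z : Fin 3),
    hWt 0 (ctAdd t (if z = 0 then (c₁, 0, 0) else if z = 1 then (0, c₂, 0) else (0, 0, 0))) z = gCF c₁ c₂ t z := by decide +kernel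

namespace MGraph

variable {V : Type*} [Fintype V] [LinearOrder V] (K : MGraph V)

section TerminalIsolated

/-- `permCT` of the swap `0 ↔ 1` (`MGraph.sw01`). (finite check) [this work] -/
theorem permCT_sw01 : ∀ t : CType, permCT sw01 t = (t.2.1, t.1, t.2.2) := by decide
/-- `permCT` of the swap `0 ↔ 2`. (finite check) [this work] -/
theorem permCT_sw02 : ∀ t : CType, permCT sw02 t = (t.2.2, t.2.1, t.1) := by decide
/-- `permCT` of the swap `1 ↔ 2`. (finite check) [this work] -/
theorem permCT_sw12 : ∀ t : CType, permCT sw12 t = (t.1, t.2.2, t.2.1) := by decide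

/-- **Colour relabelling of a pinned sum**: for a colour involution-pair `π, ψ`, `Σ_{σ s = π c} g(type σ) = Σ_{σ s = c} g(permCT ψ (type σ))`. [this work] -/
theorem sum_pin_perm (π ψ : Fin 3 → Fin 3) (hπψ : ∀ c, π (ψ c) = c) (hψπ : ∀ c, ψ (π c) = c) (s : V) (c : Fin 3) (g : CType → ℤ) :
    ∑ σ ∈ univ.filter (fun σ : V → Fin 3 => σ s = c), g (permCT ψ (K.ctypeM σ))
      = ∑ σ ∈ univ.filter (fun σ : V → Fin 3 => σ s = π c), g (K.ctypeM σ) := by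
  refine sum_nbij' (fun σ w => π (σ w)) (fun σ w => ψ (σ w)) (fun σ hσ => ?_) (fun σ hσ => ?_)
    (fun σ _ => funext fun w => hψπ (σ w)) (fun σ _ => funext fun w => hπψ (σ w)) (fun σ _ => ?_)
  · simp only [mem_filter, mem_univ, true_and] at hσ ⊢; rw [hσ]
  · simp only [mem_filter, mem_univ, true_and] at hσ ⊢; rw [hσ, hψπ]
  · rw [K.ctypeM_comp_perm π ψ hπψ hψπ σ]

variable {K}
variable {s u v : V}

/-- **Types in the terminal-isolated setting**: on a terminal-coloured colouring, `K`'s type is `L`'s type plus `ν_su ∧ 2` at colour `0` if `σ s = 0`, plus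
`ν_sv ∧ 2` at colour `1` if `σ s = 1` (`L = (K.isolate u).isolate v`; the `u–v` edges are never monochromatic). [this work] -/
theorem ctypeM_eq_of_terminalIsolated (huv : u ≠ v) (hsu : s ≠ u) (hmu : K.mark u = 0) (hmv : K.mark v = 0)
    (hiso : ∀ w, w ≠ u → w ≠ v → w ≠ s → K.mul w u = 0 ∧ K.mul w v = 0) (σ : V → Fin 3) (hu : σ u = 0) (hv : σ v = 1) :
    K.ctypeM σ = ctAdd (((K.isolate u).isolate v).ctypeM σ)
      (if σ s = 0 then (cap3 (K.mul s u), 0, 0) else if σ s = 1 then (0, cap3 (K.mul s v), 0) else (0, 0, 0)) := by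
  set L := (K.isolate u).isolate v with hL
  have h10 : ¬((1 : Fin 3) = 0) := by decide
  have h01 : ¬((0 : Fin 3) = 1) := by decide
  have h02 : ¬((0 : Fin 3) = 2) := by decide
  have h12 : ¬((1 : Fin 3) = 2) := by decide
  have lu0 : K.linkM u σ 0 = if σ s = 0 then K.mul s u else 0 := by
    unfold linkM
    rw [Finset.sum_eq_single s (fun w _ hws => ?_) (fun h => absurd (mem_univ s) h), K.symm u s]
    by_cases hwu : w = u
    · rw [hwu, K.loopless]; simp
    by_cases hwv : w = v
    · rw [hwv, hv, if_neg h10]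
    · rw [K.symm u w, (hiso w hwu hwv hws).1]; simp
  have lv1 : (K.isolate u).linkM v σ 1 = if σ s = 1 then K.mul s v else 0 := by
    unfold linkM
    rw [Finset.sum_eq_single s (fun w _ hws => ?_) (fun h => absurd (mem_univ s) h)]
    · unfold isolate; simp only [huv.symm, hsu, or_self, if_false]; rw [K.symm v s]
    by_cases hwu : w = u
    · rw [hwu]; unfold isolate; simp
    by_cases hwv : w = v
    · rw [hwv, (K.isolate u).loopless]; simp
    · have : (K.isolate u).mul v w = 0 := by
        unfold isolate; simp only [huv.symm, hwu, or_self, if_false]; rw [K.symm v w]; exact (hiso w hwu hwv hws).2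
      rw [this]; simp
  have hmv' : (K.isolate u).mark v = 0 := by unfold isolate; simp [huv.symm, hmv]
  have c0 : K.cntM σ 0 = L.cntM σ 0 + (if σ s = 0 then K.mul s u else 0) := by
    rw [K.cntM_eq_isolate_add u σ 0, if_pos hu, lu0, hmu, (K.isolate u).cntM_eq_isolate_add v σ 0, hv, if_neg h10]; ring
  have c1 : K.cntM σ 1 = L.cntM σ 1 + (if σ s = 1 then K.mul s v else 0) := by
    rw [K.cntM_eq_isolate_add u σ 1, hu, if_neg h01, (K.isolate u).cntM_eq_isolate_add v σ 1, hv, if_pos rfl, lv1, hmv']; ring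
  have c2 : K.cntM σ 2 = L.cntM σ 2 := by
    rw [K.cntM_eq_isolate_add u σ 2, hu, if_neg h02, (K.isolate u).cntM_eq_isolate_add v σ 2, hv, if_neg h12]; ring
  have tri : ∀ z : Fin 3, z = 0 ∨ z = 1 ∨ z = 2 := by decide
  unfold ctypeM
  rw [c0, c1, c2]
  rcases tri (σ s) with hz | hz | hz
  · rw [hz]; simp only [if_true, h01, if_false, add_zero]
    unfold ctAdd; simp only [cap3_add, capAdd_zero_right]
  · rw [hz]; simp only [if_true, h10, if_false, add_zero]
    unfold ctAdd; simp only [cap3_add, capAdd_zero_right]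
  · rw [hz]; simp only [show ¬((2 : Fin 3) = 0) by decide, show ¬((2 : Fin 3) = 1) by decide, if_false, add_zero]
    unfold ctAdd; simp only [capAdd_zero_right]

/-- **`9·TI₀(K) = Σ_{all σ} gCF (type_L σ) (σ s)`** in the terminal-isolated setting (`u, v` are free in `L`). [this work] -/
theorem nine_mul_TIfun_eq_sum (huv : u ≠ v) (hsu : s ≠ u) (hsv : s ≠ v) (hmu : K.mark u = 0) (hmv : K.mark v = 0)
    (hiso : ∀ w, w ≠ u → w ≠ v → w ≠ s → K.mul w u = 0 ∧ K.mul w v = 0) :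
    9 * K.TIfun 0 s u v = ∑ σ : V → Fin 3, gCF (cap3 (K.mul s u)) (cap3 (K.mul s v)) (((K.isolate u).isolate v).ctypeM σ) (σ s) := by
  set L := (K.isolate u).isolate v with hL
  set G : (V → Fin 3) → ℤ := fun σ => gCF (cap3 (K.mul s u)) (cap3 (K.mul s v)) (L.ctypeM σ) (σ s) with hG
  have hTI : K.TIfun 0 s u v = ∑ σ ∈ univ.filter (fun σ : V → Fin 3 => σ u = 0 ∧ σ v = 1), G σ := by
    unfold TIfun
    refine sum_congr rfl fun σ hσ => ?_
    obtain ⟨hu, hv⟩ := (mem_filter.1 hσ).2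
    rw [ctypeM_eq_of_terminalIsolated huv hsu hmu hmv hiso σ hu hv, hG]
    exact hWt_zero_shift _ _ _ _
  have hfu : L.IsFree u := isFree_isolate_of_isFree _ (K.isFree_isolate_self u) v
  have hfv : L.IsFree v := (K.isolate u).isFree_isolate_self v
  have hGu : ∀ σ c, G (Function.update σ u c) = G σ := fun σ c => by
    simp only [hG, L.ctypeM_update_of_isFree hfu, Function.update_of_ne hsu]
  have hGv : ∀ σ c, G (Function.update σ v c) = G σ := fun σ c => by
    simp only [hG, L.ctypeM_update_of_isFree hfv, Function.update_of_ne hsv]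
  have h1 := sum_filter_eq_three_mul u (fun _ : V → Fin 3 => True) (fun _ _ => Iff.rfl) G hGu (fun _ => 0) (fun _ _ => rfl)
  have h2 := sum_filter_eq_three_mul v (fun σ : V → Fin 3 => True ∧ σ u = 0) (fun σ c => by rw [Function.update_of_ne huv]) G hGv
    (fun _ => 1) (fun _ _ => rfl)
  have e0 : (∑ σ : V → Fin 3, G σ) = ∑ σ ∈ univ.filter (fun _ : V → Fin 3 => True), G σ := by simp
  have e2 : univ.filter (fun σ : V → Fin 3 => (True ∧ σ u = 0) ∧ σ v = 1) = univ.filter (fun σ : V → Fin 3 => σ u = 0 ∧ σ v = 1) := by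
    ext σ; simp
  rw [hTI, e0, h1, h2, e2]
  ring

/-- **THE TERMINAL-ISOLATED CASE** (memo §2 (c)+(f)): if `u ≠ v` are unmarked and no vertex other than `s ∉ {u,v}` is joined to them, then
`TI₀(K; s,u,v) ≥ 0` — by folding the three colour classes of `s` onto one, symmetrising, and LEMMA B for `L = K − u − v` (`54·TI₀ ≥ m·Q(L) ≥ 0`). [this work] -/
theorem TIfun_nonneg_of_terminalIsolated (huv : u ≠ v) (hsu : s ≠ u) (hsv : s ≠ v) (hmu : K.mark u = 0) (hmv : K.mark v = 0)
    (hiso : ∀ w, w ≠ u → w ≠ v → w ≠ s → K.mul w u = 0 ∧ K.mul w v = 0) : 0 ≤ K.TIfun 0 s u v := by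
  set L := (K.isolate u).isolate v with hL
  set c₁ := cap3 (K.mul s u) with hc₁
  set c₂ := cap3 (K.mul s v) with hc₂
  have h9 := nine_mul_TIfun_eq_sum huv hsu hsv hmu hmv hiso
  rw [← hL] at h9
  -- split by the colour of s
  have hsplit : ∑ σ : V → Fin 3, gCF c₁ c₂ (L.ctypeM σ) (σ s)
      = ∑ σ ∈ univ.filter (fun σ : V → Fin 3 => σ s = 0), fC (ctAdd (L.ctypeM σ) (capAdd c₁ 1, 0, 0))
        + ∑ σ ∈ univ.filter (fun σ : V → Fin 3 => σ s = 1), 2 * fC (ctAdd (L.ctypeM σ) (0, c₂, 0))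
        + ∑ σ ∈ univ.filter (fun σ : V → Fin 3 => σ s = 2), 2 * fC (L.ctypeM σ) := by
    rw [← sum_fiberwise univ (fun σ : V → Fin 3 => σ s) (fun σ => gCF c₁ c₂ (L.ctypeM σ) (σ s)), Fin.sum_univ_three]
    have h10 : ¬((1 : Fin 3) = 0) := by decide
    have h20 : ¬((2 : Fin 3) = 0) := by decide
    have h21 : ¬((2 : Fin 3) = 1) := by decide
    congr 1
    congr 1
    · refine sum_congr rfl fun σ hσ => ?_
      rw [(mem_filter.1 hσ).2]; unfold gCF; rw [if_pos rfl]
    · refine sum_congr rfl fun σ hσ => ?_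
      rw [(mem_filter.1 hσ).2]; unfold gCF; rw [if_neg h10, if_pos rfl]
    · refine sum_congr rfl fun σ hσ => ?_
      rw [(mem_filter.1 hσ).2]; unfold gCF; rw [if_neg h20, if_neg h21]
  -- fold the classes σ s = 1, σ s = 2 onto σ s = 0
  have f1 := L.sum_pin_perm sw01 sw01 sw01_sw01 sw01_sw01 s 0 (fun t => 2 * fC (ctAdd t (0, c₂, 0)))
  have f2 := L.sum_pin_perm sw02 sw02 sw02_sw02 sw02_sw02 s 0 (fun t => 2 * fC t)
  have e1 : sw01 0 = 1 := by decide
  have e2 : sw02 0 = 2 := by decide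
  rw [e1] at f1
  rw [e2] at f2
  simp only [permCT_sw01] at f1
  simp only [permCT_sw02] at f2
  have hk : ∑ σ : V → Fin 3, gCF c₁ c₂ (L.ctypeM σ) (σ s) = ∑ σ ∈ univ.filter (fun σ : V → Fin 3 => σ s = 0), kappaCF c₁ c₂ (L.ctypeM σ) := by
    rw [hsplit, ← f1, ← f2, ← sum_add_distrib, ← sum_add_distrib]
    refine sum_congr rfl fun σ _ => ?_
    unfold kappaCF
    ring
  -- symmetrise under 1 ↔ 2 (fixes the pin)
  have f3 := L.sum_pin_perm sw12 sw12 sw12_sw12 sw12_sw12 s 0 (kappaCF c₁ c₂)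
  have e3 : sw12 0 = 0 := by decide
  rw [e3] at f3
  simp only [permCT_sw12] at f3
  have h2 : 2 * ∑ σ ∈ univ.filter (fun σ : V → Fin 3 => σ s = 0), kappaCF c₁ c₂ (L.ctypeM σ)
      = ∑ σ ∈ univ.filter (fun σ : V → Fin 3 => σ s = 0), (kappaCF c₁ c₂ (L.ctypeM σ) + kappaCF c₁ c₂ ((L.ctypeM σ).1, (L.ctypeM σ).2.2, (L.ctypeM σ).2.1)) := by
    rw [sum_add_distrib, f3]; ring
  have hbound : (if c₂ = 0 then 6 else 4) * ∑ σ ∈ univ.filter (fun σ : V → Fin 3 => σ s = 0), lbW (L.ctypeM σ)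
      ≤ ∑ σ ∈ univ.filter (fun σ : V → Fin 3 => σ s = 0), (kappaCF c₁ c₂ (L.ctypeM σ) + kappaCF c₁ c₂ ((L.ctypeM σ).1, (L.ctypeM σ).2.2, (L.ctypeM σ).2.1)) := by
    rw [mul_sum]
    exact sum_le_sum fun σ _ => kappaCF_symm_ge c₁ c₂ _
  have hQ := L.QcolM_eq_three_mul_pin s
  have hQnn := L.QcolM_nonneg
  have hm : (0 : ℤ) ≤ (if c₂ = 0 then 6 else 4) := by split_ifs <;> norm_num
  have hpin : 0 ≤ ∑ σ ∈ univ.filter (fun σ : V → Fin 3 => σ s = 0), lbW (L.ctypeM σ) := by linarith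
  have := mul_nonneg hm hpin
  linarith

end TerminalIsolated

end MGraph

end Summit.CriticalPhenomena.PercolationContinuityZ3.Theorems.SunflowerPartition.Kempe
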